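import Mathlib.Analysis.Convex.SpecificFunctions.Basic
import Literature.MathematicalPhysics.QuantumFieldTheory.ConformalBootstrap3D.PointFunctionalHead

/-!
# Second-order box bounds for the point-functional terms (rule (M2))

The corner bounds `termCornerBound_le` (rule (M)) bound a term
`Φ(E, j, s) = Σ_k w_k [v_k^{s} 𝒫_{E,j}(z_k, z̄_k) - u_k^{s} 𝒫_{E,j}(1-z_k, 1-z̄_k)]` on a box
`[s_lo, s_hi] × [E_lo, E_hi]` by evaluating each signed piece at its worst corner; the loss is FIRST
order in the box widths times `Σ_k |w_k| …`, which near the extremal corner of a certificate exceeds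
the (small, heavily cancelling) value of `Φ`: on the K57 certificate the corner head cells at
`ℓ = 0`, `Δ = 1.7` do not certify at any width (floats). This file gives the SECOND-order rule.
Every piece is `c · r^θ · ρ^η` with `(θ, η) ∈ [0,1]²` the box coordinates, `r = v^{s_hi - s_lo}`,
`ρ = (z z̄)^{(E_hi - E_lo)/2}` (and the reflected analogues); the chord/tangent sandwich

  `1 - θ (1/r - 1) ≤ r^θ ≤ 1 - θ (1 - r)`     (`r > 0`, `θ ∈ [0,1]`; both from Bernoulli's inequality)

has a gap `θ (1-r)²/r`, second order in the width. Replacing each factor by the affine bound on the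
safe side (`termChordPiece`) gives a minorant BILINEAR in `(θ, η)`, whose minimum over the box is the
least of its four vertex values: `termChordMin`, FOUR closed-form numbers per `(j, box)`
(`termChordMin_le`). Consequences: the (M2) tail box rule `termwise_nonneg_of_chordMin` and the
chord head cells `headChord_pointFunctional_of_pointRules` (a `Φlo` table for `headCellSum`). On the
K57 certificate (floats) chord head cells certify width `2⁻⁷` at the extremal corner and `2⁻⁴ … 2⁻¹`
elsewhere with the full `Δ_σ`-box. Side condition: `r, ρ ≥ 1/2` for every node (boxes not too wide
relative to the node positions), which keeps the lower affine factors non-negative.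
Term basis: Hogervorst–Rychkov 2013, §3 eq. (3.6). [cite: HogervorstRychkov2013, §3 eq. (3.6)]
-/

noncomputable section

namespace Literature.MathematicalPhysics.QuantumFieldTheory.ConformalBootstrap3D

open Finset Set

/-! ### Chord and tangent bounds for `r^θ` -/

/-- Chord bound (Bernoulli): `r^θ ≤ 1 - θ(1 - r)` for `r ≥ 0`, `θ ∈ [0,1]`. [folklore] -/
theorem rpow_le_one_sub_mul {r θ : ℝ} (hr : 0 ≤ r) (hθ0 : 0 ≤ θ) (hθ1 : θ ≤ 1) :
    r ^ θ ≤ 1 - θ * (1 - r) := by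
  have h := rpow_one_add_le_one_add_mul_self (s := r - 1) (by linarith) hθ0 hθ1
  rw [show (1 : ℝ) + (r - 1) = r by ring] at h
  linarith

/-- Tangent-side bound: `1 - θ(1/r - 1) ≤ r^θ` for `r > 0`, `θ ∈ [0,1]` (the chord bound for `1/r`,
then `1/(1+x) ≥ 1 - x`). [folklore] -/
theorem one_sub_mul_le_rpow {r θ : ℝ} (hr : 0 < r) (hθ0 : 0 ≤ θ) (hθ1 : θ ≤ 1) :
    1 - θ * (1 / r - 1) ≤ r ^ θ := by
  have hu : 0 < 1 / r := by positivity
  have hchord := rpow_le_one_sub_mul hu.le hθ0 hθ1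
  have hprod : r ^ θ * (1 / r) ^ θ = 1 := by
    rw [← Real.mul_rpow hr.le hu.le, mul_one_div_cancel hr.ne', Real.one_rpow]
  have hpos : 0 < r ^ θ := Real.rpow_pos_of_pos hr θ
  have hupos : 0 < (1 / r) ^ θ := Real.rpow_pos_of_pos hu θ
  have hD : 0 < 1 - θ * (1 - 1 / r) := by linarith
  -- r^θ = 1 / (1/r)^θ ≥ 1 / D ≥ 1 - x
  have h1 : 1 / (1 - θ * (1 - 1 / r)) ≤ r ^ θ := by
    rw [div_le_iff₀ hD]
    have := mul_le_mul_of_nonneg_left hchord hpos.le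
    linarith
  refine le_trans ?_ h1
  rw [le_div_iff₀ hD]
  nlinarith [sq_nonneg (θ * (1 / r - 1))]

/-! ### The signed piece and its bilinear minorant -/

/-- Safe-side affine minorant of `c · r^θ · ρ^η`: lower factors for `c ≥ 0`, upper factors for
`c < 0`. [folklore] -/
def termChordPiece (c θ η r ρ : ℝ) : ℝ :=
  max c 0 * ((1 - θ * (1 / r - 1)) * (1 - η * (1 / ρ - 1)))
    - max (-c) 0 * ((1 - θ * (1 - r)) * (1 - η * (1 - ρ)))

/-- `termChordPiece c θ η r ρ ≤ c r^θ ρ^η` for `r, ρ ≥ 1/2`, `(θ, η) ∈ [0,1]²`. [folklore] -/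
theorem termChordPiece_le {c θ η r ρ : ℝ} (hr : 1 / 2 ≤ r) (hρ : 1 / 2 ≤ ρ) (hθ0 : 0 ≤ θ)
    (hθ1 : θ ≤ 1) (hη0 : 0 ≤ η) (hη1 : η ≤ 1) :
    termChordPiece c θ η r ρ ≤ c * (r ^ θ * ρ ^ η) := by
  have hr0 : 0 < r := by linarith
  have hρ0 : 0 < ρ := by linarith
  have hL1 := one_sub_mul_le_rpow hr0 hθ0 hθ1
  have hL2 := one_sub_mul_le_rpow hρ0 hη0 hη1
  have hU1 := rpow_le_one_sub_mul hr0.le hθ0 hθ1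
  have hU2 := rpow_le_one_sub_mul hρ0.le hη0 hη1
  have hβ : 1 / ρ - 1 ≤ 1 := by
    have h' : 1 / ρ ≤ 2 := by rw [div_le_iff₀ hρ0]; linarith
    linarith
  have hL2nn' : 0 ≤ 1 - η * (1 / ρ - 1) := by
    have := mul_le_mul_of_nonneg_left hβ hη0
    linarith
  have hf1 : 0 ≤ r ^ θ := Real.rpow_nonneg hr0.le θ
  have hf2 : 0 ≤ ρ ^ η := Real.rpow_nonneg hρ0.le η
  have hU1nn : 0 ≤ 1 - θ * (1 - r) := hf1.trans hU1
  -- lower product and upper product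
  have hlow : (1 - θ * (1 / r - 1)) * (1 - η * (1 / ρ - 1)) ≤ r ^ θ * ρ ^ η :=
    mul_le_mul hL1 hL2 hL2nn' hf1
  have hup : r ^ θ * ρ ^ η ≤ (1 - θ * (1 - r)) * (1 - η * (1 - ρ)) :=
    mul_le_mul hU1 hU2 hf2 hU1nn
  have hc : c = max c 0 - max (-c) 0 := by
    rcases le_or_gt 0 c with h | h
    · rw [max_eq_left h, max_eq_right (by linarith : -c ≤ 0)]; ring
    · rw [max_eq_right h.le, max_eq_left (by linarith : 0 ≤ -c)]; ring
  have hp : 0 ≤ max c 0 := le_max_right _ _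
  have hm : 0 ≤ max (-c) 0 := le_max_right _ _
  calc termChordPiece c θ η r ρ
      ≤ max c 0 * (r ^ θ * ρ ^ η) - max (-c) 0 * (r ^ θ * ρ ^ η) := by
        unfold termChordPiece
        exact sub_le_sub (mul_le_mul_of_nonneg_left hlow hp) (mul_le_mul_of_nonneg_left hup hm)
    _ = (max c 0 - max (-c) 0) * (r ^ θ * ρ ^ η) := by ring
    _ = c * (r ^ θ * ρ ^ η) := by rw [← hc]

/-- Bilinear interpolation of the piece from its four vertex values. [folklore] -/
theorem termChordPiece_interp (c θ η r ρ : ℝ) :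
    termChordPiece c θ η r ρ =
      (1 - θ) * (1 - η) * termChordPiece c 0 0 r ρ + θ * (1 - η) * termChordPiece c 1 0 r ρ
        + (1 - θ) * η * termChordPiece c 0 1 r ρ + θ * η * termChordPiece c 1 1 r ρ := by
  unfold termChordPiece
  ring

/-! ### The chord bound of a term on a box -/

/-- The bilinear chord minorant of `Φ(E, j, s)` at box coordinates `(θ, η)`:
`s = s_lo + θ (s_hi - s_lo)`, `E = E_lo + η (E_hi - E_lo)`. Direct piece of node `k`:
`c = w_k v_k^{s_lo} 𝒫_{E_lo,j}(z_k, z̄_k)`, `r = v_k^{s_hi-s_lo}`, `ρ = (z_k z̄_k)^{(E_hi-E_lo)/2}`;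
reflected piece: `c = -w_k u_k^{s_lo} 𝒫_{E_lo,j}(1-z_k, 1-z̄_k)`, `r = u_k^{s_hi-s_lo}`,
`ρ = ((1-z_k)(1-z̄_k))^{(E_hi-E_lo)/2}`. [cite: HogervorstRychkov2013, §3 eq. (3.6)] -/
def termChordBound {N : ℕ} (w z zb : Fin N → ℝ) (j : ℕ) (slo shi Elo Ehi θ η : ℝ) : ℝ :=
  ∑ k, (termChordPiece (w k * (((1 - z k) * (1 - zb k)) ^ slo * zMono Elo j (z k) (zb k))) θ η
        (((1 - z k) * (1 - zb k)) ^ (shi - slo)) ((z k * zb k) ^ ((Ehi - Elo) / 2))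
      + termChordPiece (-(w k * ((z k * zb k) ^ slo * zMono Elo j (1 - z k) (1 - zb k)))) θ η
        ((z k * zb k) ^ (shi - slo)) (((1 - z k) * (1 - zb k)) ^ ((Ehi - Elo) / 2)))

/-- The chord number of a term on a box: the least of the four vertex values of the bilinear
minorant. [cite: HogervorstRychkov2013, §3 eq. (3.6)] -/
def termChordMin {N : ℕ} (w z zb : Fin N → ℝ) (j : ℕ) (slo shi Elo Ehi : ℝ) : ℝ :=
  min (min (termChordBound w z zb j slo shi Elo Ehi 0 0) (termChordBound w z zb j slo shi Elo Ehi 1 0))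
    (min (termChordBound w z zb j slo shi Elo Ehi 0 1) (termChordBound w z zb j slo shi Elo Ehi 1 1))

/-- `𝒫_{E_lo + t, j}(x, y) = 𝒫_{E_lo, j}(x, y) · (xy)^{t/2}` (`x, y > 0`). [folklore] -/
theorem zMono_add (Elo t : ℝ) (j : ℕ) {x y : ℝ} (hx : 0 < x) (hy : 0 < y) :
    zMono (Elo + t) j x y = zMono Elo j x y * (x * y) ^ (t / 2) := by
  simp only [zMono]
  have hxy : 0 < x * y := mul_pos hx hy
  rw [show (Elo + t - (j : ℝ)) / 2 = (Elo - (j : ℝ)) / 2 + t / 2 by ring, Real.rpow_add hxy]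
  ring

/-- Bilinear interpolation of the chord minorant from its four vertex values. [folklore] -/
theorem termChordBound_interp {N : ℕ} (w z zb : Fin N → ℝ) (j : ℕ) (slo shi Elo Ehi θ η : ℝ) :
    termChordBound w z zb j slo shi Elo Ehi θ η =
      (1 - θ) * (1 - η) * termChordBound w z zb j slo shi Elo Ehi 0 0
        + θ * (1 - η) * termChordBound w z zb j slo shi Elo Ehi 1 0
        + (1 - θ) * η * termChordBound w z zb j slo shi Elo Ehi 0 1
        + θ * η * termChordBound w z zb j slo shi Elo Ehi 1 1 := by
  simp only [termChordBound, Finset.mul_sum, ← Finset.sum_add_distrib]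
  refine Finset.sum_congr rfl (fun k _ => ?_)
  rw [termChordPiece_interp _ θ η, termChordPiece_interp (-(w k * _)) θ η]
  ring

/-- **The chord bound at box coordinates.** Nodes in the open square, `s_lo ≤ s_hi`,
`E_lo ≤ E_hi`, every node's four ratios `≥ 1/2`; then for `(θ, η) ∈ [0,1]²`
`termChordBound … θ η ≤ Φ(E_lo + η (E_hi - E_lo), j, s_lo + θ (s_hi - s_lo))`.
[cite: HogervorstRychkov2013, §3 eq. (3.6)] -/
theorem termChordBound_le {N : ℕ} (w z zb : Fin N → ℝ)
    (hz : ∀ k, z k ∈ Ioo (0 : ℝ) 1) (hzb : ∀ k, zb k ∈ Ioo (0 : ℝ) 1) (j : ℕ)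
    {slo shi Elo Ehi θ η : ℝ}
    (hr : ∀ k, 1 / 2 ≤ ((1 - z k) * (1 - zb k)) ^ (shi - slo) ∧ 1 / 2 ≤ (z k * zb k) ^ (shi - slo))
    (hρ : ∀ k, 1 / 2 ≤ (z k * zb k) ^ ((Ehi - Elo) / 2) ∧
      1 / 2 ≤ ((1 - z k) * (1 - zb k)) ^ ((Ehi - Elo) / 2))
    (hθ : θ ∈ Icc (0 : ℝ) 1) (hη : η ∈ Icc (0 : ℝ) 1) :
    termChordBound w z zb j slo shi Elo Ehi θ η ≤
      pointFunctional w z zb (crossF (slo + θ * (shi - slo)) (-1)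
        (zMono (Elo + η * (Ehi - Elo)) j)) := by
  rw [pointFunctional_apply]
  unfold termChordBound
  refine Finset.sum_le_sum (fun k _ => ?_)
  have hzk := hz k; have hzbk := hzb k
  have hv : 0 < (1 - z k) * (1 - zb k) := mul_pos (by linarith [hzk.2]) (by linarith [hzbk.2])
  have hu : 0 < z k * zb k := mul_pos hzk.1 hzbk.1
  -- the two pieces
  have h1 := termChordPiece_le (c := w k * (((1 - z k) * (1 - zb k)) ^ slo * zMono Elo j (z k) (zb k)))
    (hr k).1 (hρ k).1 hθ.1 hθ.2 hη.1 hη.2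
  have h2 := termChordPiece_le (c := -(w k * ((z k * zb k) ^ slo * zMono Elo j (1 - z k) (1 - zb k))))
    (hr k).2 (hρ k).2 hθ.1 hθ.2 hη.1 hη.2
  -- rewrite the exact term
  have hvs : ((1 - z k) * (1 - zb k)) ^ (slo + θ * (shi - slo)) =
      ((1 - z k) * (1 - zb k)) ^ slo * (((1 - z k) * (1 - zb k)) ^ (shi - slo)) ^ θ := by
    rw [Real.rpow_add hv, ← Real.rpow_mul hv.le, mul_comm (shi - slo) θ]
  have hus : (z k * zb k) ^ (slo + θ * (shi - slo)) =
      (z k * zb k) ^ slo * ((z k * zb k) ^ (shi - slo)) ^ θ := by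
    rw [Real.rpow_add hu, ← Real.rpow_mul hu.le, mul_comm (shi - slo) θ]
  have hEd : zMono (Elo + η * (Ehi - Elo)) j (z k) (zb k) =
      zMono Elo j (z k) (zb k) * ((z k * zb k) ^ ((Ehi - Elo) / 2)) ^ η := by
    rw [zMono_add Elo _ j hzk.1 hzbk.1, ← Real.rpow_mul hu.le]
    congr 1; congr 1; ring
  have hEr : zMono (Elo + η * (Ehi - Elo)) j (1 - z k) (1 - zb k) =
      zMono Elo j (1 - z k) (1 - zb k) * (((1 - z k) * (1 - zb k)) ^ ((Ehi - Elo) / 2)) ^ η := by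
    rw [zMono_add Elo _ j (by linarith [hzk.2]) (by linarith [hzbk.2]), ← Real.rpow_mul hv.le]
    congr 1; congr 1; ring
  have key : termChordPiece (w k * (((1 - z k) * (1 - zb k)) ^ slo * zMono Elo j (z k) (zb k))) θ η
        (((1 - z k) * (1 - zb k)) ^ (shi - slo)) ((z k * zb k) ^ ((Ehi - Elo) / 2))
      + termChordPiece (-(w k * ((z k * zb k) ^ slo * zMono Elo j (1 - z k) (1 - zb k)))) θ η
        ((z k * zb k) ^ (shi - slo)) (((1 - z k) * (1 - zb k)) ^ ((Ehi - Elo) / 2)) ≤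
      w k * (((1 - z k) * (1 - zb k)) ^ (slo + θ * (shi - slo)) *
          zMono (Elo + η * (Ehi - Elo)) j (z k) (zb k))
        + -(w k * ((z k * zb k) ^ (slo + θ * (shi - slo)) *
          zMono (Elo + η * (Ehi - Elo)) j (1 - z k) (1 - zb k))) := by
    rw [hvs, hus, hEd, hEr]
    calc _ ≤ w k * (((1 - z k) * (1 - zb k)) ^ slo * zMono Elo j (z k) (zb k)) *
            ((((1 - z k) * (1 - zb k)) ^ (shi - slo)) ^ θ * ((z k * zb k) ^ ((Ehi - Elo) / 2)) ^ η)
          + -(w k * ((z k * zb k) ^ slo * zMono Elo j (1 - z k) (1 - zb k))) *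
            (((z k * zb k) ^ (shi - slo)) ^ θ * (((1 - z k) * (1 - zb k)) ^ ((Ehi - Elo) / 2)) ^ η) :=
          add_le_add h1 h2
      _ = _ := by ring
  refine key.trans (le_of_eq ?_)
  simp only [crossF]
  ring

/-- The least vertex value bounds the bilinear minorant on the box. [folklore] -/
theorem termChordMin_le_termChordBound {N : ℕ} (w z zb : Fin N → ℝ) (j : ℕ)
    (slo shi Elo Ehi : ℝ) {θ η : ℝ} (hθ : θ ∈ Icc (0 : ℝ) 1) (hη : η ∈ Icc (0 : ℝ) 1) :
    termChordMin w z zb j slo shi Elo Ehi ≤ termChordBound w z zb j slo shi Elo Ehi θ η := by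
  rw [termChordBound_interp]
  set m := termChordMin w z zb j slo shi Elo Ehi with hm
  have h00 : m ≤ termChordBound w z zb j slo shi Elo Ehi 0 0 :=
    (min_le_left _ _).trans (min_le_left _ _)
  have h10 : m ≤ termChordBound w z zb j slo shi Elo Ehi 1 0 :=
    (min_le_left _ _).trans (min_le_right _ _)
  have h01 : m ≤ termChordBound w z zb j slo shi Elo Ehi 0 1 :=
    (min_le_right _ _).trans (min_le_left _ _)
  have h11 : m ≤ termChordBound w z zb j slo shi Elo Ehi 1 1 :=
    (min_le_right _ _).trans (min_le_right _ _)
  have w00 : 0 ≤ (1 - θ) * (1 - η) := mul_nonneg (by linarith [hθ.2]) (by linarith [hη.2])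
  have w10 : 0 ≤ θ * (1 - η) := mul_nonneg hθ.1 (by linarith [hη.2])
  have w01 : 0 ≤ (1 - θ) * η := mul_nonneg (by linarith [hθ.2]) hη.1
  have w11 : 0 ≤ θ * η := mul_nonneg hθ.1 hη.1
  have hsum : m = (1 - θ) * (1 - η) * m + θ * (1 - η) * m + (1 - θ) * η * m + θ * η * m := by ring
  rw [hsum]
  gcongr

/-- **Rule (M2): the chord number bounds the term on the whole box.** Nodes in the open square,
`s_lo ≤ s_hi`, `E_lo ≤ E_hi`, node ratios `≥ 1/2`; then
`termChordMin … ≤ Φ(E, j, s)` for all `s ∈ [s_lo, s_hi]`, `E ∈ [E_lo, E_hi]`.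
[cite: HogervorstRychkov2013, §3 eq. (3.6)] -/
theorem termChordMin_le {N : ℕ} (w z zb : Fin N → ℝ)
    (hz : ∀ k, z k ∈ Ioo (0 : ℝ) 1) (hzb : ∀ k, zb k ∈ Ioo (0 : ℝ) 1) (j : ℕ)
    {slo shi Elo Ehi : ℝ}
    (hr : ∀ k, 1 / 2 ≤ ((1 - z k) * (1 - zb k)) ^ (shi - slo) ∧ 1 / 2 ≤ (z k * zb k) ^ (shi - slo))
    (hρ : ∀ k, 1 / 2 ≤ (z k * zb k) ^ ((Ehi - Elo) / 2) ∧
      1 / 2 ≤ ((1 - z k) * (1 - zb k)) ^ ((Ehi - Elo) / 2))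
    {s E : ℝ} (hs : s ∈ Icc slo shi) (hE : E ∈ Icc Elo Ehi) :
    termChordMin w z zb j slo shi Elo Ehi ≤ pointFunctional w z zb (crossF s (-1) (zMono E j)) := by
  -- box coordinates
  obtain ⟨θ, hθ, hsθ⟩ : ∃ θ : ℝ, θ ∈ Icc (0 : ℝ) 1 ∧ s = slo + θ * (shi - slo) := by
    rcases eq_or_lt_of_le (hs.1.trans hs.2) with h | h
    · exact ⟨0, ⟨le_rfl, zero_le_one⟩, by simp; linarith [hs.1, hs.2]⟩
    · have hne : shi - slo ≠ 0 := ne_of_gt (sub_pos.2 h)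
      refine ⟨(s - slo) / (shi - slo), ⟨div_nonneg (by linarith [hs.1]) (by linarith),
        (div_le_one (by linarith)).2 (by linarith [hs.2])⟩, ?_⟩
      rw [div_mul_cancel₀ _ hne]; ring
  obtain ⟨η, hη, hEη⟩ : ∃ η : ℝ, η ∈ Icc (0 : ℝ) 1 ∧ E = Elo + η * (Ehi - Elo) := by
    rcases eq_or_lt_of_le (hE.1.trans hE.2) with h | h
    · exact ⟨0, ⟨le_rfl, zero_le_one⟩, by simp; linarith [hE.1, hE.2]⟩
    · have hne : Ehi - Elo ≠ 0 := ne_of_gt (sub_pos.2 h)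
      refine ⟨(E - Elo) / (Ehi - Elo), ⟨div_nonneg (by linarith [hE.1]) (by linarith),
        (div_le_one (by linarith)).2 (by linarith [hE.2])⟩, ?_⟩
      rw [div_mul_cancel₀ _ hne]; ring
  rw [hsθ, hEη]
  exact (termChordMin_le_termChordBound w z zb j slo shi Elo Ehi hθ hη).trans
    (termChordBound_le w z zb hz hzb j hr hρ hθ hη)

/-- **(M2) box by box.** `0 ≤ termChordMin` on a box gives termwise positivity on it.
[cite: HogervorstRychkov2013, §3 eq. (3.6)] -/
theorem termwise_nonneg_of_chordMin {N : ℕ} (w z zb : Fin N → ℝ)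
    (hz : ∀ k, z k ∈ Ioo (0 : ℝ) 1) (hzb : ∀ k, zb k ∈ Ioo (0 : ℝ) 1) (j : ℕ)
    {slo shi Elo Ehi : ℝ}
    (hr : ∀ k, 1 / 2 ≤ ((1 - z k) * (1 - zb k)) ^ (shi - slo) ∧ 1 / 2 ≤ (z k * zb k) ^ (shi - slo))
    (hρ : ∀ k, 1 / 2 ≤ (z k * zb k) ^ ((Ehi - Elo) / 2) ∧
      1 / 2 ≤ ((1 - z k) * (1 - zb k)) ^ ((Ehi - Elo) / 2))
    (h : 0 ≤ termChordMin w z zb j slo shi Elo Ehi) :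
    ∀ E ∈ Icc Elo Ehi, ∀ s ∈ Icc slo shi,
      0 ≤ pointFunctional w z zb (crossF s (-1) (zMono E j)) :=
  fun _ hE _ hs => h.trans (termChordMin_le w z zb hz hzb j hr hρ hs hE)

/-! ### Chord head cells -/

/-- The chord head-cell number: `headCellSum` with the chord numbers of the head terms on
`[a+n, b+n] × [s_lo, s_hi]`. [cite: HogervorstRychkov2013, §3 eq. (3.9)] -/
def headChordBound {N : ℕ} (w z zb : Fin N → ℝ) (ℓ : ℕ) (a b slo shi : ℝ)
    (F : Finset (ℕ × ℕ)) : ℝ :=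
  headCellSum ℓ a b F (fun q => termChordMin w z zb q.2 slo shi (a + q.1) (b + q.1))

/-- **Chord head cell from the certificate's global data.** As
`headSum_pointFunctional_of_pointRules` with the chord numbers: node ratios `≥ 1/2` for the
`s`-width and the cell width, `headChordBound ≥ 0` ⟹ block positivity on the half-open cell for
every external dimension in the box. [cite: HogervorstRychkov2013, §3 eq. (3.9)] -/
theorem headChord_pointFunctional_of_pointRules {N : ℕ} (w z zb : Fin N → ℝ)
    (hz : ∀ k, z k ∈ Ioo (0 : ℝ) 1) (hzb : ∀ k, zb k ∈ Ioo (0 : ℝ) 1) (hord : ∀ k, zb k ≤ z k)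
    (apex : Fin N) (hapex : 0 ≤ w apex) (qd qr : Fin N → ℝ) (hqd : ∀ k, 0 < qd k ∧ qd k ≤ 1)
    (hqr : ∀ k, 0 < qr k ∧ qr k ≤ 1)
    (hdomd : ∀ k, z k * zb k ≤ qd k ^ 2 * (z apex * zb apex) ∧ z k ≤ qd k * z apex)
    (hdomr : ∀ k, (1 - z k) * (1 - zb k) ≤ qr k ^ 2 * (z apex * zb apex) ∧
      1 - zb k ≤ qr k * z apex)
    {Q : Set (ℝ × ℝ)} {slo shi E₀ ET : ℝ} (hQ : ∀ p ∈ Q, slo ≤ p.1 ∧ p.1 ≤ shi)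
    (hM : ∀ (j : ℕ) (E : ℝ), E₀ ≤ E → E < ET → (j : ℝ) + 1 / 2 ≤ E → ∀ p ∈ Q,
      0 ≤ pointFunctional w z zb (crossF p.1 (-1) (zMono E j)))
    (hB : ∑ k ∈ univ.erase apex, |w k| * ((1 - z k) * (1 - zb k)) ^ slo * qd k ^ ET
          + ∑ k, |w k| * (z k * zb k) ^ slo * qr k ^ ET ≤
          w apex * ((1 - z apex) * (1 - zb apex)) ^ shi)
    {ℓ : ℕ} {a b : ℝ} (ha : (ℓ : ℝ) + 1 ≤ a) (F : Finset (ℕ × ℕ))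
    (hF : ∀ q : ℕ × ℕ, q ∉ F → InDescendantRange ℓ q.1 q.2 → E₀ ≤ a + q.1)
    (hr : ∀ k, 1 / 2 ≤ ((1 - z k) * (1 - zb k)) ^ (shi - slo) ∧ 1 / 2 ≤ (z k * zb k) ^ (shi - slo))
    (hρ : ∀ k, 1 / 2 ≤ (z k * zb k) ^ ((b - a) / 2) ∧ 1 / 2 ≤ ((1 - z k) * (1 - zb k)) ^ ((b - a) / 2))
    (hhead : 0 ≤ headChordBound w z zb ℓ a b slo shi F) :
    ∀ p ∈ Q, ∀ Δ ∈ Ico a b, BlockPositive (pointFunctional w z zb) p.1 Δ ℓ :=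
  headSum_pointFunctional_of_pointRules w z zb hz hzb hord apex hapex qd qr hqd hqr hdomd hdomr hQ hM
    hB ha F hF _
    (fun q _ Δ hΔ p hp => by
      have hρ' : ∀ k, 1 / 2 ≤ (z k * zb k) ^ ((b + (q.1 : ℝ) - (a + q.1)) / 2) ∧
          1 / 2 ≤ ((1 - z k) * (1 - zb k)) ^ ((b + (q.1 : ℝ) - (a + q.1)) / 2) := by
        intro k; rw [show b + (q.1 : ℝ) - (a + q.1) = b - a by ring]; exact hρ k
      exact termChordMin_le w z zb hz hzb q.2 hr hρ' ⟨(hQ p hp).1, (hQ p hp).2⟩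
        (⟨by linarith [hΔ.1], by linarith [hΔ.2]⟩ : Δ + (q.1 : ℝ) ∈ Icc (a + q.1) (b + q.1)))
    hhead

end Literature.MathematicalPhysics.QuantumFieldTheory.ConformalBootstrap3D
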